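import Summits.BirchSwinnertonDyer.BirchSwinnertonDyer.Theses.PAdicOrder
import Literature.NumberTheory.EllipticCurves.KatoRankBound
import Literature.NumberTheory.EllipticCurves.SelmerCorankHolds
import Literature.NumberTheory.DiophantineGeometry.Conductor
import Literature.NumberTheory.EllipticCurves.OrdinaryPrimesProofs

/-!
# Crux idea `kato-sandwich-one-prime` — first lemmas (crux `PAdicOrderThesisR2`, stmt-0487)

X := `PAdicOrderThesisR2` (∃ good ordinary p with ord_T L_p = r_an ∧ ord_T L_p = r_MW).

Lever: Kato's height-free inequality `r_MW ≤ ord_T L_p(f, α_p, T)` (odd good ordinary p) turns X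
into a SANDWICH of two inequalities at ONE prime:
  `OnePrimeUB`  : ∃ p ≥ 5 good ordinary, ord_T L_p(f, α_p, T) ≤ r_an   (p-adic, f-intrinsic)
  `LB`          : r_an ≤ r_MW                                           (classical, shared)
so that `r_MW ≤ ord ≤ r_an ≤ r_MW` forces BOTH clauses of X; Schneider non-degeneracy,
Ш[p^∞]-finiteness, T-semisimplicity and the main conjecture at that prime become OUTPUT.

Completion (B) replaces `LB` by Selmer data at the SAME prime (`OnePrimeUBSha`): Kato's
Selmer-corank form + the corank identity `corank Sel = r_MW + corank Ш[p^∞]` (proved in tree).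

Everything below elaborates; the two glue theorems are sorry-free.
-/

namespace Summit.BirchSwinnertonDyer.BirchSwinnertonDyer.Cruxes.PAdicOrderThesisR2.KatoSandwich

open Literature.NumberTheory.EllipticCurves Literature.NumberTheory.EllipticCurves.ModularForms

/-- **OnePrimeUB** (the new p-adic stub): for every `E/ℚ` (globally minimal `W`) there is a good
ordinary prime `p ≥ 5` at which, for every newform `f` of `E`, the unit-root p-adic L-function
vanishes at `T = 0` to order AT MOST the analytic rank. A statement about the newform alone. -/
def OnePrimeUB : Prop :=
  ∀ (W : WeierstrassCurve ℚ) [W.IsElliptic] [W.IsGloballyMinimal],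
    ∃ (p : ℕ) (_ : Fact p.Prime), 5 ≤ p ∧ IsOrdinaryAt W p ∧
      ∀ {N : ℕ} [NeZero N] (f : CuspForm (CongruenceSubgroup.Gamma0 N) 2),
        IsNewformOf W f →
          (padicLFunction f (unitRoot W p : ℚ_[p])).order ≤ (W.analyticRank : ℕ∞)

/-- **LB** (classical lower bound, shared with Squeeze / HigherGrossZagier / SelmerRank):
`r_an ≤ r_MW` (stated for globally minimal models, which is all the glue needs). -/
def LB : Prop :=
  ∀ (W : WeierstrassCurve ℚ) [W.IsElliptic] [W.IsGloballyMinimal],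
    W.analyticRank ≤ W.mordellWeilRank

/-- Kato's rank bound, universally quantified: the Literature fact
`kato_mordellWeilRank_le_order_padicLFunction` (Kato 2004, Thm 18.4), = route support item
`PAdicOrderKatoSideR2` up to currying. -/
def KatoRankBound : Prop :=
  ∀ (W : WeierstrassCurve ℚ) [W.IsElliptic] [W.IsGloballyMinimal] (p : ℕ) [Fact p.Prime]
    {N : ℕ} [NeZero N] {f : CuspForm (CongruenceSubgroup.Gamma0 N) 2},
    kato_mordellWeilRank_le_order_padicLFunction W p (f := f)

/-- Kato's Selmer-corank bound, universally quantified (fact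
`kato_selmerCorank_le_order_padicLFunction`, Kato 2004 Thm 18.4). -/
def KatoSelmerBound : Prop :=
  ∀ (W : WeierstrassCurve ℚ) [W.IsElliptic] [W.IsGloballyMinimal] (p : ℕ) [Fact p.Prime]
    {N : ℕ} [NeZero N] {f : CuspForm (CongruenceSubgroup.Gamma0 N) 2},
    kato_selmerCorank_le_order_padicLFunction W p (f := f)

/-- Modularity, unfolded exactly as in the route's glue `CruxesToThesis` (body of the cite-only
fact `ModularForms.exists_isNewformOf`, rfl-equal). -/
def Modularity : Prop :=
  ∀ (W : WeierstrassCurve ℚ) [W.IsElliptic] [NeZero (W.conductorNorm ℤ)],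
    ∃ f : CuspForm (CongruenceSubgroup.Gamma0 (W.conductorNorm ℤ)) 2, IsNewformOf W f

theorem modularity_iff : Modularity ↔ exists_isNewformOf := Iff.rfl

/-- **Completion (A): the sandwich.** `Modularity → Kato → OnePrimeUB → LB → X`. Sorry-free. -/
theorem thesis_of_onePrimeUB_of_LB (hmod : Modularity) (hK : KatoRankBound) (hUB : OnePrimeUB)
    (hLB : LB) :
    Summit.BirchSwinnertonDyer.BirchSwinnertonDyer.Theses.PAdicOrder.PAdicOrderThesisR2 := by
  intro W _ _
  obtain ⟨p, hp, h5, hord, hub⟩ := hUB W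
  haveI : NeZero (W.conductorNorm ℤ) := ⟨(W.conductorNorm_pos_holds).ne'⟩
  obtain ⟨f, hf⟩ := hmod W
  have hp2 : p ≠ 2 := by omega
  have h1 : (W.mordellWeilRank : ℕ∞) ≤ (padicLFunction f (unitRoot W p : ℚ_[p])).order :=
    hK W p hp2 hord hf
  have h2 : (padicLFunction f (unitRoot W p : ℚ_[p])).order ≤ (W.analyticRank : ℕ∞) :=
    hub f hf
  have h3 : (W.analyticRank : ℕ∞) ≤ (W.mordellWeilRank : ℕ∞) := by exact_mod_cast hLB W
  exact ⟨p, hp, hord, W.conductorNorm ℤ, inferInstance, f, hf, le_antisymm h2 (h3.trans h1),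
    le_antisymm (h2.trans h3) h1⟩

/-- **OnePrimeUBSha** (completion (B), one "doubly honest" prime): a good ordinary `p ≥ 5` with
`ord_T L_p ≤ r_an`, `Ш(E)[p^∞]` of corank `0`, and the Selmer lower bound `r_an ≤ corank Sel_{p^∞}`
(the last is KNOWN for `r_an ≤ 3` at big-image ordinary `p`: Skinner–Urban rank-0 converse,
Skinner/W. Zhang rank-1 converse, p-parity). No rational point is constructed. -/
def OnePrimeUBSha : Prop :=
  ∀ (W : WeierstrassCurve ℚ) [W.IsElliptic] [W.IsGloballyMinimal],
    ∃ (p : ℕ) (_ : Fact p.Prime), 5 ≤ p ∧ IsOrdinaryAt W p ∧ W.shaCorank p = 0 ∧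
      W.analyticRank ≤ W.selmerCorank p ∧
      ∀ {N : ℕ} [NeZero N] (f : CuspForm (CongruenceSubgroup.Gamma0 N) 2),
        IsNewformOf W f →
          (padicLFunction f (unitRoot W p : ℚ_[p])).order ≤ (W.analyticRank : ℕ∞)

/-- **Completion (B):** `Modularity → Kato (Selmer form) → OnePrimeUBSha → X`, using the PROVED
corank identity `selmerCorank_eq_mordellWeilRank_add_holds`. Sorry-free. -/
theorem thesis_of_onePrimeUBSha (hmod : Modularity) (hK : KatoSelmerBound)
    (hUB : OnePrimeUBSha) :
    Summit.BirchSwinnertonDyer.BirchSwinnertonDyer.Theses.PAdicOrder.PAdicOrderThesisR2 := by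
  intro W _ _
  obtain ⟨p, hp, h5, hord, hsha, hlb, hub⟩ := hUB W
  haveI : NeZero (W.conductorNorm ℤ) := ⟨(W.conductorNorm_pos_holds).ne'⟩
  obtain ⟨f, hf⟩ := hmod W
  have hp2 : p ≠ 2 := by omega
  have hid : W.selmerCorank p = W.mordellWeilRank + W.shaCorank p :=
    W.selmerCorank_eq_mordellWeilRank_add_holds p
  rw [hsha, add_zero] at hid
  have h1 : (W.selmerCorank p : ℕ∞) ≤ (padicLFunction f (unitRoot W p : ℚ_[p])).order :=
    hK W p hp2 hord hf
  rw [hid] at h1 hlb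
  have h2 : (padicLFunction f (unitRoot W p : ℚ_[p])).order ≤ (W.analyticRank : ℕ∞) :=
    hub f hf
  have h3 : (W.analyticRank : ℕ∞) ≤ (W.mordellWeilRank : ℕ∞) := by exact_mod_cast hlb
  exact ⟨p, hp, hord, W.conductorNorm ℤ, inferInstance, f, hf, le_antisymm h2 (h3.trans h1),
    le_antisymm (h2.trans h3) h1⟩

/-- Sanity: the route's cruxes #2 (∀p comparison) and LB imply `OnePrimeUB` — the new stub is a
WEAKENING of what the route currently asks (one prime, one inequality), given the tree theorem
`exists_good_ordinary_prime_holds`. -/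
theorem onePrimeUB_of_comparison
    (h2 : Summit.BirchSwinnertonDyer.BirchSwinnertonDyer.Theses.PAdicOrder.PAdicOrderComparisonR2) :
    OnePrimeUB := by
  intro W _ _
  obtain ⟨p, hp, h5, hgood, hord⟩ := WeierstrassCurve.exists_good_ordinary_prime_holds W
  exact ⟨p, hp, h5, ⟨hgood, hord⟩, fun f hf => (h2 W p ⟨hgood, hord⟩ f hf).le⟩

end Summit.BirchSwinnertonDyer.BirchSwinnertonDyer.Cruxes.PAdicOrderThesisR2.KatoSandwich
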